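import Literature.Probability.RandomPlanarGeometry.SAWWords
import Literature.Probability.RandomPlanarGeometry.SAWBridges
import HarnessLib

/-!
# Bridges and irreducible bridges as step words; unique decoding of concatenations

Topic `Literature/Probability/RandomPlanarGeometry` (continues `SAWWords.lean`; the vertex-function
bridges `Zd.IsBridge`, `Zd.bridges` are in `SAWBridges.lean`). Kesten's renewal structure of bridges
(Kesten 1963; Madras–Slade 1993, §1.2 and §4.2): a bridge `ω` (`0 = ω₁(0) < ω₁(i) ≤ ω₁(n)`) is
**irreducible** if it is not the concatenation of two bridges, i.e. has no *break point* `0 < j < n`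
with `ω₁(i) ≤ ω₁(j)` for `i ≤ j` and `ω₁(i) > ω₁(j)` for `i > j`; every bridge factors uniquely into
irreducible bridges. We need (and prove) exactly the following, on step words:

* `xAt w i` (first coordinate after `i` steps), `xEnd w` (the span), `IsBridgeW w`
  (`= Zd.IsBridge |w| (traj w)`), `traj_mem_bridges`;
* concatenation: `IsBridgeW.append`, `IsSAW.append_of_bridge` (Madras–Slade (1.2.15));
* `IsBreak`, `IsIrreducible`, `IsIrrBridge`, and the criterion `isIrreducible_of_crossings`
  (no internal column gap is crossed exactly once ⇒ irreducible), via `crossings_eq_one_of_isBreak`;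
* **unique decoding** `eq_of_append_eq`: if `s ++ t = s' ++ t'` with `s, s'` irreducible bridges and
  `t, t'` bridges then `s = s'` (the first factor of Kesten's factorisation is determined).

## References

* H. Kesten, *On the number of self-avoiding walks*, J. Math. Phys. 4 (1963) 960–969, §4.
* N. Madras, G. Slade, *The Self-Avoiding Walk* (1993), Definition 1.2.4, eq. (1.2.15), §4.2
  (break points, eq. (4.2.1); irreducible bridges, Definition 4.2.1; the renewal equation (4.2.2)).
-/

open Finset Literature.Probability.LatticeModels
open scoped BigOperators

namespace Literature.Probability.RandomPlanarGeometry.SAW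

/-! ### The first coordinate along a word -/

/-- First coordinate of the walk `w` after `i` steps. [folklore] -/
def xAt (w : List Step) (i : ℕ) : ℤ := traj w i 0

/-- The **span** (final first coordinate) of `w`. [cite: MadrasSlade1993, Definition 1.2.4] -/
def xEnd (w : List Step) : ℤ := xAt w w.length

/-- `xAt w 0 = 0`. [folklore] -/
@[simp] theorem xAt_zero (w : List Step) : xAt w 0 = 0 := by simp [xAt]

/-- One step changes the first coordinate by `dx`. [folklore] -/
theorem xAt_succ (w : List Step) {i : ℕ} (hi : i < w.length) :
    xAt w (i + 1) = xAt w i + Step.dx (w[i]) := by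
  simp [xAt, traj_succ w hi]

/-- The first coordinate is frozen after `|w|`. [folklore] -/
theorem xAt_of_le (w : List Step) {i : ℕ} (hi : w.length ≤ i) : xAt w i = xEnd w := by
  simp [xAt, xEnd, traj_of_le w hi]

/-- `xEnd w = wEnd w 0`. [folklore] -/
theorem xEnd_eq (w : List Step) : xEnd w = wEnd w 0 := by simp [xEnd, xAt]

/-- Consecutive first coordinates differ by at most one. [folklore] -/
theorem abs_xAt_succ_sub_le (w : List Step) (i : ℕ) : |xAt w (i + 1) - xAt w i| ≤ 1 := by
  rcases lt_or_ge i w.length with hi | hi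
  · rw [xAt_succ w hi, add_sub_cancel_left]
    unfold Step.dx; split_ifs <;> simp
  · rw [xAt_of_le w hi, xAt_of_le w (Nat.le_succ_of_le hi), sub_self]; simp

/-- `xAt` of a concatenation, left part. [folklore] -/
theorem xAt_append_left (u v : List Step) {i : ℕ} (hi : i ≤ u.length) : xAt (u ++ v) i = xAt u i := by
  simp [xAt, traj_append_left u v hi]

/-- `xAt` of a concatenation, right part. [folklore] -/
theorem xAt_append_right (u v : List Step) (i : ℕ) :
    xAt (u ++ v) (u.length + i) = xEnd u + xAt v i := by
  simp [xAt, xEnd, traj_append_right u v i]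

/-- Span of a concatenation. [folklore] -/
theorem xEnd_append (u v : List Step) : xEnd (u ++ v) = xEnd u + xEnd v := by
  rw [xEnd, List.length_append, xAt_append_right, xEnd, xEnd]

/-! ### Bridges -/

/-- **Bridge** (as a step word): `0 < x(i) ≤ x(|w|)` for `1 ≤ i ≤ |w|`; by definition this is
`Zd.IsBridge |w| (traj w)` of `SAWBridges.lean`. [cite: MadrasSlade1993, Definition 1.2.4] -/
def IsBridgeW (w : List Step) : Prop := Zd.IsBridge w.length (traj w)

/-- Unfolding of `IsBridgeW` in terms of `xAt`. [cite: MadrasSlade1993, Definition 1.2.4] -/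
theorem isBridgeW_iff (w : List Step) :
    IsBridgeW w ↔ ∀ i, 1 ≤ i → i ≤ w.length → 0 < xAt w i ∧ xAt w i ≤ xEnd w := by
  simp only [IsBridgeW, Zd.IsBridge, xAt, xEnd, traj_zero]
  rfl

/-- The span of a bridge is non-negative. [folklore] -/
theorem IsBridgeW.xEnd_nonneg {w : List Step} (h : IsBridgeW w) : 0 ≤ xEnd w := by
  rcases Nat.eq_zero_or_pos w.length with h0 | h0
  · rw [xEnd, h0, xAt_zero]
  · exact ((isBridgeW_iff w).1 h w.length h0 le_rfl).1.le

/-- All first coordinates of a bridge are at most its span (also at `i = 0` and after `|w|`).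
[folklore] -/
theorem IsBridgeW.xAt_le {w : List Step} (h : IsBridgeW w) (i : ℕ) : xAt w i ≤ xEnd w := by
  rcases Nat.eq_zero_or_pos i with rfl | hi
  · simpa using h.xEnd_nonneg
  · rcases le_or_gt i w.length with hi' | hi'
    · exact ((isBridgeW_iff w).1 h i hi hi').2
    · rw [xAt_of_le w hi'.le]

/-- The empty word is a bridge. [folklore] -/
theorem isBridgeW_nil : IsBridgeW [] := by
  rw [isBridgeW_iff]; intro i h1 h2; simp at h2; omega

/-- A self-avoiding bridge word of length `n` gives an element of `Zd.bridges 2 n`.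
[cite: MadrasSlade1993, Definition 1.2.4] -/
theorem traj_mem_bridges {n : ℕ} {w : List Step} (hl : w.length = n) (hs : IsSAW w)
    (hb : IsBridgeW w) : traj w ∈ Zd.bridges 2 n := by
  rw [Zd.mem_bridges]
  refine ⟨traj_mem_saws hl hs, ?_⟩
  rw [← hl]; exact hb

/-- **Concatenation of bridges is a bridge.** [cite: MadrasSlade1993, §1.2, eq. (1.2.15)] -/
theorem IsBridgeW.append {u v : List Step} (hu : IsBridgeW u) (hv : IsBridgeW v) :
    IsBridgeW (u ++ v) := by
  rw [isBridgeW_iff] at hu hv ⊢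
  intro i h1 h2
  rw [xEnd_append]
  have hv0 : 0 ≤ xEnd v := IsBridgeW.xEnd_nonneg ((isBridgeW_iff v).2 hv)
  rcases le_or_gt i u.length with hi | hi
  · rw [xAt_append_left u v hi]
    obtain ⟨a, b⟩ := hu i h1 hi
    exact ⟨a, by linarith⟩
  · obtain ⟨k, rfl⟩ : ∃ k, i = u.length + k := ⟨i - u.length, by omega⟩
    rw [List.length_append] at h2
    rw [xAt_append_right]
    obtain ⟨a, b⟩ := hv k (by omega) (by omega)
    have hu0 : 0 ≤ xEnd u := IsBridgeW.xEnd_nonneg ((isBridgeW_iff u).2 hu)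
    exact ⟨by linarith, by linarith⟩

/-- **Concatenation of self-avoiding bridges is self-avoiding**: the second piece lives strictly
to the right of the first. [cite: MadrasSlade1993, §1.2, eq. (1.2.15)] -/
theorem IsSAW.append_of_bridge {u v : List Step} (hsu : IsSAW u) (hsv : IsSAW v)
    (hu : IsBridgeW u) (hv : IsBridgeW v) : IsSAW (u ++ v) := by
  rw [isSAW_iff_injOn] at hsu hsv ⊢
  have hvb := (isBridgeW_iff v).1 hv
  -- points of the right part (k ≥ 1) have first coordinate > xEnd u ≥ points of the left part
  have key : ∀ i ≤ u.length, ∀ k, 1 ≤ k → k ≤ v.length →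
      traj (u ++ v) i ≠ traj (u ++ v) (u.length + k) := by
    intro i hi k hk1 hk2 h
    have hx := congrFun h 0
    change xAt (u ++ v) i = xAt (u ++ v) (u.length + k) at hx
    rw [xAt_append_left u v hi, xAt_append_right] at hx
    have h1 := hu.xAt_le i
    have h2 := (hvb k hk1 hk2).1
    linarith
  intro i hi j hj hij
  simp only [Set.mem_setOf_eq, List.length_append] at hi hj
  rcases le_or_gt i u.length with hi' | hi' <;> rcases le_or_gt j u.length with hj' | hj'
  · rw [traj_append_left u v hi', traj_append_left u v hj'] at hij
    exact hsu hi' hj' hij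
  · obtain ⟨k, rfl⟩ : ∃ k, j = u.length + k := ⟨j - u.length, by omega⟩
    exact absurd hij (key i hi' k (by omega) (by omega))
  · obtain ⟨k, rfl⟩ : ∃ k, i = u.length + k := ⟨i - u.length, by omega⟩
    exact absurd hij.symm (key j hj' k (by omega) (by omega))
  · obtain ⟨k, rfl⟩ : ∃ k, i = u.length + k := ⟨i - u.length, by omega⟩
    obtain ⟨k', rfl⟩ : ∃ k', j = u.length + k' := ⟨j - u.length, by omega⟩
    rw [traj_append_right, traj_append_right, add_right_inj] at hij
    have := hsv (show k ≤ v.length by omega) (show k' ≤ v.length by omega) hij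
    omega

/-! ### Break points, irreducible bridges -/

/-- **Break point** `j` of `w` (`0 < j < |w|`): the first coordinate is `≤ x(j)` up to time `j`
and `> x(j)` afterwards, so that `w` is the concatenation of the bridges `w[0,j]` and `w[j,|w|]`.
[cite: MadrasSlade1993, §4.2, eq. (4.2.1)] -/
def IsBreak (w : List Step) (j : ℕ) : Prop :=
  0 < j ∧ j < w.length ∧ (∀ i ≤ j, xAt w i ≤ xAt w j) ∧ ∀ i, j < i → i ≤ w.length → xAt w j < xAt w i

/-- **Irreducible** word: no break point. [cite: MadrasSlade1993, §4.2, Definition 4.2.1] -/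
def IsIrreducible (w : List Step) : Prop := ∀ j, ¬ IsBreak w j

/-- **Irreducible bridge** (non-empty, self-avoiding). [cite: Kesten1963SAW, §4] -/
structure IsIrrBridge (w : List Step) : Prop where
  /-- self-avoiding -/
  saw : IsSAW w
  /-- a bridge -/
  bridge : IsBridgeW w
  /-- no break point -/
  irr : IsIrreducible w
  /-- at least one step -/
  ne_nil : w ≠ []

/-- The number of steps of `w` across the column gap `{h, h+1}` (in either direction).
[cite: Jensen2004SAWLowerBounds, §2.1] -/
def crossings (w : List Step) (h : ℤ) : ℕ :=
  ((List.range w.length).filter fun i =>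
    (xAt w i = h ∧ xAt w (i + 1) = h + 1) ∨ (xAt w i = h + 1 ∧ xAt w (i + 1) = h)).length

/-- At a break point the gap above its column is crossed exactly once. [cite: Kesten1963SAW, §4] -/
theorem crossings_eq_one_of_isBreak {w : List Step} {j : ℕ} (hj : IsBreak w j) :
    crossings w (xAt w j) = 1 := by
  obtain ⟨h0, hjl, hle, hgt⟩ := hj
  have key : ∀ i ∈ List.range w.length,
      (decide ((xAt w i = xAt w j ∧ xAt w (i + 1) = xAt w j + 1) ∨
          (xAt w i = xAt w j + 1 ∧ xAt w (i + 1) = xAt w j))) = decide (i = j) := by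
    intro i hi
    rw [List.mem_range] at hi
    rw [decide_eq_decide]
    constructor
    · rintro (⟨h1, h2⟩ | ⟨h1, h2⟩)
      · by_contra hne
        rcases lt_or_gt_of_ne hne with hlt | hlt
        · have := hle (i + 1) hlt; omega
        · have := hgt i hlt hi.le; omega
      · rcases lt_trichotomy i j with hlt | rfl | hlt
        · have := hle i hlt.le; omega
        · omega
        · have := hgt (i + 1) (by omega) hi; omega
    · rintro rfl
      left
      refine ⟨rfl, ?_⟩
      have h1 := hgt (i + 1) (Nat.lt_succ_self i) hi
      have h2 := abs_xAt_succ_sub_le w i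
      rw [abs_le] at h2
      omega
  rw [crossings, List.filter_congr key, List.filter_eq, List.length_replicate, List.count_range,
    if_pos hjl]

/-- **Irreducibility criterion**: a bridge none of whose internal column gaps `{h, h+1}`,
`1 ≤ h < span`, is crossed exactly once has no break point. (At a break point `j`, the gap above
column `x(j) ∈ [1, span)` is crossed once.) [cite: Jensen2004SAWLowerBounds, §2.1] -/
theorem isIrreducible_of_crossings {w : List Step} (hb : IsBridgeW w)
    (h : ∀ h : ℤ, 1 ≤ h → h < xEnd w → crossings w h ≠ 1) : IsIrreducible w := by
  intro j hj
  have hc := crossings_eq_one_of_isBreak hj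
  obtain ⟨h0, hjl, -, hgt⟩ := hj
  refine h (xAt w j) ?_ ?_ hc
  · exact ((isBridgeW_iff w).1 hb j h0 hjl.le).1
  · have := hgt w.length hjl le_rfl
    rwa [xEnd]

/-! ### Unique decoding: the first irreducible factor is determined -/

/-- If `s` is a proper prefix of `s'`, `s` a non-empty bridge and the remainder followed by a
bridge is a bridge, then `|s|` is a break point of `s'`. [cite: Kesten1963SAW, §4] -/
theorem isBreak_length_of_prefix {s u t' : List Step} (hs : IsBridgeW s) (hne : s ≠ [])
    (hu : u ≠ []) (ht : IsBridgeW (u ++ t')) : IsBreak (s ++ u) s.length := by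
  refine ⟨by rw [List.length_pos_iff]; exact hne, by simp [List.length_pos_iff.2 hu], ?_, ?_⟩
  · intro i hi
    rw [xAt_append_left s u hi, xAt_append_left s u le_rfl]
    exact hs.xAt_le i
  · intro i hi1 hi2
    obtain ⟨k, rfl⟩ : ∃ k, i = s.length + k := ⟨i - s.length, by omega⟩
    rw [List.length_append] at hi2
    rw [xAt_append_left s u le_rfl, xAt_append_right, ← xEnd]
    have hk : xAt u k = xAt (u ++ t') k := (xAt_append_left u t' (by omega)).symm
    rw [hk]
    have := ((isBridgeW_iff _).1 ht k (by omega) (by simp; omega)).1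
    linarith

/-- **Unique decoding.** If `s ++ t = s' ++ t'` where `s, s'` are irreducible bridges and `t, t'`
are bridges, then `s = s'` (and hence `t = t'`): Kesten's factorisation of a bridge into
irreducible bridges is unique. [cite: Kesten1963SAW, §4] -/
theorem eq_of_append_eq {s s' t t' : List Step} (hs : IsIrrBridge s) (hs' : IsIrrBridge s')
    (ht : IsBridgeW t) (ht' : IsBridgeW t') (h : s ++ t = s' ++ t') : s = s' := by
  -- without loss of generality `|s| ≤ |s'|`
  wlog hle : s.length ≤ s'.length generalizing s s' t t'
  · exact (this hs' hs ht' ht h.symm (by omega)).symm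
  rcases hle.eq_or_lt with heq | hlt
  · exact List.append_inj_left h heq
  · exfalso
    -- `s' = s ++ u` with `u = s'.drop |s|` non-empty and `t = u ++ t'`
    set u := s'.drop s.length with hu_def
    have e1 : s'.take s.length = s := by
      have := congrArg (List.take s.length) h
      rwa [List.take_append_of_le_length le_rfl, List.take_length,
        List.take_append_of_le_length hle, eq_comm] at this
    have e2 : s' = s ++ u := by
      conv_lhs => rw [← List.take_append_drop s.length s']
      rw [e1]
    have e3 : t = u ++ t' := by
      have := congrArg (List.drop s.length) h
      rwa [List.drop_left, List.drop_append_of_le_length hle] at this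
    have hu : u ≠ [] := by
      rw [ne_eq, ← List.length_eq_zero_iff, hu_def, List.length_drop]; omega
    have hb := isBreak_length_of_prefix hs.bridge hs.ne_nil hu (e3 ▸ ht)
    rw [← e2] at hb
    exact hs'.irr _ hb

/-- Unique decoding, with the tails. [cite: Kesten1963SAW, §4] -/
theorem eq_of_append_eq' {s s' t t' : List Step} (hs : IsIrrBridge s) (hs' : IsIrrBridge s')
    (ht : IsBridgeW t) (ht' : IsBridgeW t') (h : s ++ t = s' ++ t') : s = s' ∧ t = t' := by
  have h1 := eq_of_append_eq hs hs' ht ht' h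
  subst h1
  exact ⟨rfl, List.append_cancel_left h⟩

end Literature.Probability.RandomPlanarGeometry.SAW
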